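import Summits.CriticalPhenomena.PercolationContinuityZ3.Theorems.Transplant.SkelFrmBChoiceRootRun
import HarnessLib

/-!
# N2 (frames-only node `SamePDropOfSkeletonFrm₁`, OPEN), (R) column SECOND axis — **(R-46)(d): THE ROOT'S x-PREFIX AT ITS OWN MINIMAL SLOTS**
# (`HKx := kgRows0_of mk 0 0`: `q = 2·n_L`, `W = ⌊sL⌋₊`; run length the numeral `KS.Nx := 30`): `m₁P_le` (`m₁(30)+1 ≤ 3`), `X₂P_le` (`≤ 6·n_L`),
# **`hrowP`** (the skeleton's `hnR ∧ hrow` for the prefix), `m₂P_le` (`m₂(30)+1 ≤ 18`), `XP_bounds` (`0 ≤ X(30) ≤ 12·n_L`), `farP_bounds`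
# (`31·n_L ≤ kgFar … 30 ≤ 43·n_L`: the prefix's last core lies `x ∈ X1 + [30·n_L + 1, 43·n_L]` east of `t`), `lastP_rows` (its rows
# `⊂ [−(sL+2), 3·sL]`), `reachP_le` (`13·(31·n_L + Z₀(30) + Z₁(30)) ≤ KS.ZDP := 13·(46·n_L + 10·⌊sL⌋₊)`, the prefix's depth budget for `hRD`),
# `schedLenP_le` (`≤ 52` steps).
WHY ((R-38)/(R-46)(d), lane INBOX 2026-08-23T12:17:36Z/12:33:02Z, p3-g17): the x-prefix is only the y′-corridor's core-0 feeder and the seed's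
x-clearance; at the root's own minimal slots its values are small numerals, generic in `(g, f, mk)` under `EqNumL`, `gFloorKG ≤ g`, `40·K·R′0 ≤ g`.
builds on p205010 (kernel theorem, internal audit signed; external expert review pending) — nothing in this file uses p205010; nothing here is a
claim about the open node `SamePDropOfSkeletonFrm₁`.
Lane `prim-bschramm`, seat `prim-bschramm-p3` (gen 17; (R) lineage); helper file (`--supports stmt-CriticalPhenomena-4575 --as helper`).
[cite: KozmaNitzan2024, §4 Lemma 12 (pp. 23–25), p. 28 ((32) at the root)] [cite: MartineauTassion2017, §4.3 Lemma 4.2 (steering)]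
-/

noncomputable section

open scoped Classical

namespace Summit.CriticalPhenomena.PercolationContinuityZ3.Theorems.Transplant

namespace PlanarSkeletonFrm

namespace NegB

open Literature.Probability.Percolation Literature.Probability.LatticeModels SimpleGraph
open SkelConc (Consts)
open Skelφ (shearUnit kgSL kgP kgΔ kgN KGRows kgFar kgX kgX₂ kgM₁ kgM₂ kgT₁ kgWm₂ kgWp₂ kgZ₀ kgZ₁ kgCtr2 kgHw2 kgDec₁)
open Neg

namespace KS

section Prefix

variable (κ : Consts) {V : Type} [DecidableEq V] [Countable V] {G : SimpleGraph V} [G.LocallyFinite] (Φ : PlanarSkeletonFrm G) (t : V) (p : unitInterval)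
  (D : Skelφ.StepI.DataNS V) (mk g f : ℕ)

/-- **The prefix run length of record** `Nx := 30`. [this work] -/
def Nx : ℕ := 30

/-- `Nx = 30`. [folklore] -/
theorem Nx_eq : Nx = 30 := rfl

/-- **The prefix's depth budget** `ZDP := 13·(46·n_L + 10·⌊sL⌋₊)`. [this work] -/
def ZDP : ℕ := 13 * (46 * (nL κ Φ t p D g f) + 10 * ((kgSL (nL κ Φ t p D g f) (ℓL κ Φ t p D g f) (hL κ Φ t p D g f))).toNat)

/-- The prefix slots unfolded: `kgq 0 = 2·n_L`, `kgW 0 = ⌊sL⌋₊ = sL`, and the floors used below. [folklore] -/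
theorem prefix_floors (hN : EqNumL κ Φ t p D g f) (hg : gFloorKG κ Φ t p D mk ≤ g) (hg2 : 40 * Neg.K κ * KS0.R'0 κ Φ t p D mk ≤ g) :
    (((kgq κ Φ t p D g f 0) : ℕ) : ℤ) = 2 * (nL κ Φ t p D g f : ℤ) ∧ (((kgW κ Φ t p D g f 0) : ℕ) : ℤ) = (kgSL (nL κ Φ t p D g f) (ℓL κ Φ t p D g f) (hL κ Φ t p D g f)) ∧ 1600 * (((KS0.R'0 κ Φ t p D mk) : ℕ) : ℤ) + 1 ≤ (nL κ Φ t p D g f : ℤ) ∧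
      1600 * (((KS0.R'0 κ Φ t p D mk) : ℕ) : ℤ) ≤ (kgSL (nL κ Φ t p D g f) (ℓL κ Φ t p D g f) (hL κ Φ t p D g f)) + 1 ∧ 958 ≤ (kgSL (nL κ Φ t p D g f) (ℓL κ Φ t p D g f) (hL κ Φ t p D g f)) ∧ |(vL κ Φ t p D g f)| ≤ (nL κ Φ t p D g f : ℤ) := by
  obtain ⟨h1, h2, h3, -, hK, -⟩ := valsQ_floor κ Φ t p D g f mk hN hg hg2
  have hs0 : 0 ≤ (kgSL (nL κ Φ t p D g f) (ℓL κ Φ t p D g f) (hL κ Φ t p D g f)) := by linarith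
  refine ⟨by unfold kgq; push_cast; ring, by unfold kgW; push_cast; rw [Int.toNat_of_nonneg hs0]; ring, by nlinarith, by nlinarith, h3, hN.v_le⟩

/-- **`m₁(30) + 1 ≤ 3`** (`2sL(m₁+1) ≤ 6W + 186R′ = 6sL + 186R′ < 8sL`). [this work] -/
theorem m₁P_le (hN : EqNumL κ Φ t p D g f) (hg : gFloorKG κ Φ t p D mk ≤ g) (hg2 : 40 * Neg.K κ * KS0.R'0 κ Φ t p D mk ≤ g) : (((kgM₁ (nL κ Φ t p D g f) (ℓL κ Φ t p D g f) (hL κ Φ t p D g f) (kgR κ Φ t p D mk) 0 (kgW κ Φ t p D g f 0) 30) : ℕ) : ℤ) + 1 ≤ 3 := by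
  have H := (kgRows0_of κ Φ t p D g f mk 0 0 hN hg)
  obtain ⟨hS, -, -, -, -⟩ := kg_floors κ Φ t p D g f mk 0 hN hg (by have := (valsQ_floor κ Φ t p D g f mk hN hg hg2).2.2.1; push_cast; linarith)
  have hb := H.kgM₁_budget hS 30
  obtain ⟨-, hW, -, hRs, h958, -⟩ := prefix_floors κ Φ t p D mk g f hN hg hg2
  have eR : (kgR κ Φ t p D mk) = (KS0.R'0 κ Φ t p D mk) := rfl
  unfold kgT₁ at hb
  rw [eR] at hb
  rw [hW] at hb
  set a := (((kgM₁ (nL κ Φ t p D g f) (ℓL κ Φ t p D g f) (hL κ Φ t p D g f) (KS0.R'0 κ Φ t p D mk) 0 (kgW κ Φ t p D g f 0) 30) : ℕ) : ℤ) + 1 with ha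
  have h4 : 2 * (kgSL (nL κ Φ t p D g f) (ℓL κ Φ t p D g f) (hL κ Φ t p D g f)) * a < 2 * (kgSL (nL κ Φ t p D g f) (ℓL κ Φ t p D g f) (hL κ Φ t p D g f)) * 4 := by push_cast at hb; nlinarith
  have := lt_of_mul_lt_mul_left h4 (by linarith)
  rw [eR]; linarith

/-- **`2·n_L ≤ X₂(30) ≤ 6·n_L`.** [this work] -/
theorem X₂P_bounds (hN : EqNumL κ Φ t p D g f) (hg : gFloorKG κ Φ t p D mk ≤ g) (hg2 : 40 * Neg.K κ * KS0.R'0 κ Φ t p D mk ≤ g) : 2 * (nL κ Φ t p D g f : ℤ) ≤ (kgX₂ (nL κ Φ t p D g f) (ℓL κ Φ t p D g f) (hL κ Φ t p D g f) (vL κ Φ t p D g f) (kgR κ Φ t p D mk) 0 (kgq κ Φ t p D g f 0) (kgW κ Φ t p D g f 0) 30) ∧ (kgX₂ (nL κ Φ t p D g f) (ℓL κ Φ t p D g f) (hL κ Φ t p D g f) (vL κ Φ t p D g f) (kgR κ Φ t p D mk) 0 (kgq κ Φ t p D g f 0) (kgW κ Φ t p D g f 0) 30) ≤ 6 * (nL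 κ Φ t p D g f : ℤ) := by
  have ha := m₁P_le κ Φ t p D mk g f hN hg hg2
  obtain ⟨hq, -, hRn, -, -, hv⟩ := prefix_floors κ Φ t p D mk g f hN hg hg2
  have eR : (kgR κ Φ t p D mk) = (KS0.R'0 κ Φ t p D mk) := rfl
  unfold kgX₂
  rw [eR] at ha ⊢
  rw [hq]
  have ha0 : (0 : ℤ) ≤ (((kgM₁ (nL κ Φ t p D g f) (ℓL κ Φ t p D g f) (hL κ Φ t p D g f) (KS0.R'0 κ Φ t p D mk) 0 (kgW κ Φ t p D g f 0) 30) : ℕ) : ℤ) := by positivity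
  have hR0 : (0 : ℤ) ≤ (((KS0.R'0 κ Φ t p D mk) : ℕ) : ℤ) := by positivity
  have hva : (0 : ℤ) ≤ |(vL κ Φ t p D g f)| := abs_nonneg _
  constructor
  · push_cast; nlinarith
  · have h3 : ((((kgM₁ (nL κ Φ t p D g f) (ℓL κ Φ t p D g f) (hL κ Φ t p D g f) (KS0.R'0 κ Φ t p D mk) 0 (kgW κ Φ t p D g f 0) 30) : ℕ) : ℤ) + 1) * ((((KS0.R'0 κ Φ t p D mk) : ℕ) : ℤ) + ((0 : ℕ) : ℤ) + |(vL κ Φ t p D g f)|) ≤ 3 * (((KS0.R'0 κ Φ t p D mk) : ℕ) : ℤ) + 3 * (nL κ Φ t p D g f : ℤ) := by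
      push_cast; nlinarith
    push_cast at h3 ⊢; nlinarith

/-- **THE SKELETON'S `hnR ∧ hrow` FOR THE PREFIX** (`HKx := kgRows0_of mk 0 0`, `Nx := 30`): `R′0 ≤ n_L` and
`2n_L + 31·R′0 + (m₁(30)+1)(R′0 + 0 + |v_L|) + n_L ≤ 31·n_L`. [this work] -/
theorem hrowP (hN : EqNumL κ Φ t p D g f) (hg : gFloorKG κ Φ t p D mk ≤ g) (hg2 : 40 * Neg.K κ * KS0.R'0 κ Φ t p D mk ≤ g) :
    KS0.R'0 κ Φ t p D mk ≤ (nL κ Φ t p D g f) ∧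
    (((kgq κ Φ t p D g f 0) : ℕ) : ℤ) + ((Nx : ℤ) + 1) * (((KS0.R'0 κ Φ t p D mk) : ℕ) : ℤ) +
        (((((kgM₁ (nL κ Φ t p D g f) (ℓL κ Φ t p D g f) (hL κ Φ t p D g f) (KS0.R'0 κ Φ t p D mk) 0 (kgW κ Φ t p D g f 0) Nx) : ℕ) : ℤ)) + 1) * ((((KS0.R'0 κ Φ t p D mk) : ℕ) : ℤ) + ((0 : ℕ) : ℤ) + |(vL κ Φ t p D g f)|) + (nL κ Φ t p D g f : ℤ) ≤ ((Nx : ℤ) + 1) * (nL κ Φ t p D g f : ℤ) := by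
  obtain ⟨-, hX⟩ := X₂P_bounds κ Φ t p D mk g f hN hg hg2
  obtain ⟨-, -, hRn, -, -, -⟩ := prefix_floors κ Φ t p D mk g f hN hg hg2
  have eR : (kgR κ Φ t p D mk) = (KS0.R'0 κ Φ t p D mk) := rfl
  have eX : (kgX₂ (nL κ Φ t p D g f) (ℓL κ Φ t p D g f) (hL κ Φ t p D g f) (vL κ Φ t p D g f) (kgR κ Φ t p D mk) 0 (kgq κ Φ t p D g f 0) (kgW κ Φ t p D g f 0) 30) = (((kgq κ Φ t p D g f 0) : ℕ) : ℤ) + ((30 : ℕ) + 1 : ℤ) * (((kgR κ Φ t p D mk) : ℕ) : ℤ) +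
      (((((kgM₁ (nL κ Φ t p D g f) (ℓL κ Φ t p D g f) (hL κ Φ t p D g f) (kgR κ Φ t p D mk) 0 (kgW κ Φ t p D g f 0) 30) : ℕ) : ℤ)) + 1) * ((((kgR κ Φ t p D mk) : ℕ) : ℤ) + ((0 : ℕ) : ℤ) + |(vL κ Φ t p D g f)|) := by unfold kgX₂; push_cast; ring
  rw [Nx_eq]
  constructor
  · have hR0 : (0 : ℤ) ≤ (((KS0.R'0 κ Φ t p D mk) : ℕ) : ℤ) := by positivity
    have : (((KS0.R'0 κ Φ t p D mk) : ℕ) : ℤ) ≤ (nL κ Φ t p D g f : ℤ) := by linarith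
    exact_mod_cast this
  · rw [eR] at eX hX; push_cast at eX hX ⊢; linarith

/-- **`m₂(30) + 1 ≤ 18`** (`2n(m₂+1) ≤ 6X₂ + 3 ≤ 36n + 3 < 38n`). [this work] -/
theorem m₂P_le (hN : EqNumL κ Φ t p D g f) (hg : gFloorKG κ Φ t p D mk ≤ g) (hg2 : 40 * Neg.K κ * KS0.R'0 κ Φ t p D mk ≤ g) : (((kgM₂ (nL κ Φ t p D g f) (ℓL κ Φ t p D g f) (hL κ Φ t p D g f) (vL κ Φ t p D g f) (kgR κ Φ t p D mk) 0 (kgq κ Φ t p D g f 0) (kgW κ Φ t p D g f 0) 30) : ℕ) : ℤ) + 1 ≤ 18 := by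
  have H := (kgRows0_of κ Φ t p D g f mk 0 0 hN hg)
  obtain ⟨-, hX⟩ := X₂P_bounds κ Φ t p D mk g f hN hg hg2
  obtain ⟨-, -, hRn, -, -, -⟩ := prefix_floors κ Φ t p D mk g f hN hg hg2
  obtain ⟨-, hSn, -, -, -⟩ := kg_floors κ Φ t p D g f mk 0 hN hg (by have := (valsQ_floor κ Φ t p D g f mk hN hg hg2).2.2.1; push_cast; linarith)
  have hb := H.kgM₂_succ_budget hSn 30
  set b := (((kgM₂ (nL κ Φ t p D g f) (ℓL κ Φ t p D g f) (hL κ Φ t p D g f) (vL κ Φ t p D g f) (kgR κ Φ t p D mk) 0 (kgq κ Φ t p D g f 0) (kgW κ Φ t p D g f 0) 30) : ℕ) : ℤ) + 1 with hb'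
  have hR1 : (1 : ℤ) ≤ (((KS0.R'0 κ Φ t p D mk) : ℕ) : ℤ) := (valsQ_floor κ Φ t p D g f mk hN hg hg2).2.2.2.1
  have h19 : 2 * (nL κ Φ t p D g f : ℤ) * b < 2 * (nL κ Φ t p D g f : ℤ) * 19 := by linarith
  have := lt_of_mul_lt_mul_left h19 (by linarith)
  linarith

/-- **`0 ≤ X(30) ≤ 12·n_L`** (the arrival overshoot of the prefix). [this work] -/
theorem XP_bounds (hN : EqNumL κ Φ t p D g f) (hg : gFloorKG κ Φ t p D mk ≤ g) (hg2 : 40 * Neg.K κ * KS0.R'0 κ Φ t p D mk ≤ g) : 0 ≤ (kgX (nL κ Φ t p D g f) (ℓL κ Φ t p D g f) (hL κ Φ t p D g f) (vL κ Φ t p D g f) (kgR κ Φ t p D mk) 0 (kgq κ Φ t p D g f 0) (kgW κ Φ t p D g f 0) 30) ∧ (kgX (nL κ Φ t p D g f) (ℓL κ Φ t p D g f) (hL κ Φ t p D g f) (vL κ Φ t p D g f) (kgR κ Φ t p D mk) 0 (kgq κ Φ t p D g f 0) (kgW κ Φ t p D g f 0) 30) ≤ 12 * (nL κ Φ t p D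 g f : ℤ) := by
  have H := (kgRows0_of κ Φ t p D g f mk 0 0 hN hg)
  obtain ⟨-, hX⟩ := X₂P_bounds κ Φ t p D mk g f hN hg hg2
  obtain ⟨-, -, hS₂, -, -⟩ := kg_floors κ Φ t p D g f mk 0 hN hg (by have := (valsQ_floor κ Φ t p D g f mk hN hg hg2).2.2.1; push_cast; linarith)
  have hb := H.kgX_budget hS₂ 30
  have hR0 : (0 : ℤ) ≤ (((kgR κ Φ t p D mk) : ℕ) : ℤ) := by positivity
  exact ⟨Skelφ.kgX_nonneg _, by push_cast at hb; linarith⟩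

/-- **THE PREFIX'S LAST CORE, ALONG**: `31·n_L ≤ kgFar … 30 ≤ 43·n_L`, so the core `[kgFar − (n_L − 1), kgFar]` lies in `[30·n_L + 1, 43·n_L]` in
the `c₁`-frame (in the `t`-frame: `+ X1`, RootRun `X1_bounds`). [this work] -/
theorem farP_bounds (hN : EqNumL κ Φ t p D g f) (hg : gFloorKG κ Φ t p D mk ≤ g) (hg2 : 40 * Neg.K κ * KS0.R'0 κ Φ t p D mk ≤ g) : 31 * (nL κ Φ t p D g f : ℤ) ≤ (kgFar (nL κ Φ t p D g f) (ℓL κ Φ t p D g f) (hL κ Φ t p D g f) (vL κ Φ t p D g f) (kgR κ Φ t p D mk) 0 (kgq κ Φ t p D g f 0) (kgW κ Φ t p D g f 0) 30) ∧ (kgFar (nL κ Φ t p D g f) (ℓL κ Φ t p D g f) (hL κ Φ t p D g f) (vL κ Φ t p D g f) (kgR κ Φ t p D mk) 0 (kgq κ Φ t p D g f 0) (kgW κ Φ t p D g f 0) 30) ≤ 43 * (nL κ Φ t p D g f : ℤ) := by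
  obtain ⟨h0, h12⟩ := XP_bounds κ Φ t p D mk g f hN hg hg2
  unfold kgFar; push_cast
  constructor <;> linarith

/-- **THE PREFIX'S LAST CORE, ROWS**: `−(sL + 2) ≤ kgLastLo 1` and `kgLastHi 1 ≤ 3·sL` (`A₁ = P + sL + 31R′`, `E₁ < 2P + dec₁`, `P ≤ sL + 2`). [this work] -/
theorem lastP_rows (hN : EqNumL κ Φ t p D g f) (hg : gFloorKG κ Φ t p D mk ≤ g) (hg2 : 40 * Neg.K κ * KS0.R'0 κ Φ t p D mk ≤ g) :
    -((kgSL (nL κ Φ t p D g f) (ℓL κ Φ t p D g f) (hL κ Φ t p D g f)) + 2) ≤ ((kgRows0_of κ Φ t p D g f mk 0 0 hN hg).kgLastLo 30) 1 ∧ ((kgRows0_of κ Φ t p D g f mk 0 0 hN hg).kgLastHi 30) 1 ≤ 3 * (kgSL (nL κ Φ t p D g f) (ℓL κ Φ t p D g f) (hL κ Φ t p D g f)) := by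
  have H := (kgRows0_of κ Φ t p D g f mk 0 0 hN hg)
  have ha := m₁P_le κ Φ t p D mk g f hN hg hg2
  have hb := m₂P_le κ Φ t p D mk g f hN hg hg2
  obtain ⟨-, hW, hRn, hRs, h958, -⟩ := prefix_floors κ Φ t p D mk g f hN hg hg2
  obtain ⟨-, hE2, hE3⟩ := H.kgE₁_spec 30
  have hP : ((((nL κ Φ t p D g f) * (ℓL κ Φ t p D g f) / shearUnit (nL κ Φ t p D g f) (hL κ Φ t p D g f) : ℕ)) : ℤ) ≤ (kgSL (nL κ Φ t p D g f) (ℓL κ Φ t p D g f) (hL κ Φ t p D g f)) + 1 :=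
    Skelφ.natDiv_le_kgSLY (n := (nL κ Φ t p D g f)) (one_le_of_eqNumL κ Φ t p D g f hN).1 (ℓL κ Φ t p D g f) (hL κ Φ t p D g f)
  have eA : ((Skelφ.kgA₁ (nL κ Φ t p D g f) (ℓL κ Φ t p D g f) (hL κ Φ t p D g f) (kgR κ Φ t p D mk) (kgW κ Φ t p D g f 0) 30 : ℕ) : ℤ) = (((nL κ Φ t p D g f) * (ℓL κ Φ t p D g f) / shearUnit (nL κ Φ t p D g f) (hL κ Φ t p D g f) + 1 : ℕ) : ℤ) + (kgW κ Φ t p D g f 0) + (30 + 1) * (kgR κ Φ t p D mk) := by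
    unfold Skelφ.kgA₁; push_cast; ring
  have hRs' : 1600 * (((kgR κ Φ t p D mk) : ℕ) : ℤ) ≤ (kgSL (nL κ Φ t p D g f) (ℓL κ Φ t p D g f) (hL κ Φ t p D g f)) + 1 := hRs
  have hR0 : (0 : ℤ) ≤ (((kgR κ Φ t p D mk) : ℕ) : ℤ) := by positivity
  have hm₁0 : (0 : ℤ) ≤ (((kgM₁ (nL κ Φ t p D g f) (ℓL κ Φ t p D g f) (hL κ Φ t p D g f) (kgR κ Φ t p D mk) 0 (kgW κ Φ t p D g f 0) 30) : ℕ) : ℤ) := by positivity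
  have hm₂0 : (0 : ℤ) ≤ (((kgM₂ (nL κ Φ t p D g f) (ℓL κ Φ t p D g f) (hL κ Φ t p D g f) (vL κ Φ t p D g f) (kgR κ Φ t p D mk) 0 (kgq κ Φ t p D g f 0) (kgW κ Φ t p D g f 0) 30) : ℕ) : ℤ) := by positivity
  have h1 : ((((kgM₁ (nL κ Φ t p D g f) (ℓL κ Φ t p D g f) (hL κ Φ t p D g f) (kgR κ Φ t p D mk) 0 (kgW κ Φ t p D g f 0) 30) : ℕ) : ℤ) + 1) * ((((kgR κ Φ t p D mk) : ℕ) : ℤ) + ((0 : ℕ) : ℤ)) ≤ 3 * (((kgR κ Φ t p D mk) : ℕ) : ℤ) := by push_cast; nlinarith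
  have h2 : ((((kgM₂ (nL κ Φ t p D g f) (ℓL κ Φ t p D g f) (hL κ Φ t p D g f) (vL κ Φ t p D g f) (kgR κ Φ t p D mk) 0 (kgq κ Φ t p D g f 0) (kgW κ Φ t p D g f 0) 30) : ℕ) : ℤ) + 1) * ((((kgR κ Φ t p D mk) : ℕ) : ℤ) + ((0 : ℕ) : ℤ)) ≤ 18 * (((kgR κ Φ t p D mk) : ℕ) : ℤ) := by push_cast; nlinarith
  have h1' : (0 : ℤ) ≤ ((((kgM₁ (nL κ Φ t p D g f) (ℓL κ Φ t p D g f) (hL κ Φ t p D g f) (kgR κ Φ t p D mk) 0 (kgW κ Φ t p D g f 0) 30) : ℕ) : ℤ) + 1) * ((((kgR κ Φ t p D mk) : ℕ) : ℤ) + ((0 : ℕ) : ℤ)) := by positivity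
  have h2' : (0 : ℤ) ≤ ((((kgM₂ (nL κ Φ t p D g f) (ℓL κ Φ t p D g f) (hL κ Φ t p D g f) (vL κ Φ t p D g f) (kgR κ Φ t p D mk) 0 (kgq κ Φ t p D g f 0) (kgW κ Φ t p D g f 0) 30) : ℕ) : ℤ) + 1) * ((((kgR κ Φ t p D mk) : ℕ) : ℤ) + ((0 : ℕ) : ℤ)) := by positivity
  have hd : kgDec₁ (nL κ Φ t p D g f) (ℓL κ Φ t p D g f) (hL κ Φ t p D g f) (kgR κ Φ t p D mk) 0 = (kgSL (nL κ Φ t p D g f) (ℓL κ Φ t p D g f) (hL κ Φ t p D g f)) - 2 * (((kgR κ Φ t p D mk) : ℕ) : ℤ) - ((0 : ℕ) : ℤ) := rfl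
  rw [hd] at hE3
  unfold kgP at hE2 hE3
  have hlo : -(2 * ((kgSL (nL κ Φ t p D g f) (ℓL κ Φ t p D g f) (hL κ Φ t p D g f)) + 2)) + 1 ≤ kgCtr2 (nL κ Φ t p D g f) (ℓL κ Φ t p D g f) (hL κ Φ t p D g f) (kgR κ Φ t p D mk) 0 (kgW κ Φ t p D g f 0) 30 - kgHw2 (nL κ Φ t p D g f) (ℓL κ Φ t p D g f) (hL κ Φ t p D g f) (vL κ Φ t p D g f) (kgR κ Φ t p D mk) 0 (kgq κ Φ t p D g f 0) (kgW κ Φ t p D g f 0) 30 + 1 := by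
    unfold kgCtr2 kgHw2; push_cast at eA hE2 hE3 hP hW h1 h2 h1' h2' ⊢; linarith
  have hhi : kgCtr2 (nL κ Φ t p D g f) (ℓL κ Φ t p D g f) (hL κ Φ t p D g f) (kgR κ Φ t p D mk) 0 (kgW κ Φ t p D g f 0) 30 + kgHw2 (nL κ Φ t p D g f) (ℓL κ Φ t p D g f) (hL κ Φ t p D g f) (vL κ Φ t p D g f) (kgR κ Φ t p D mk) 0 (kgq κ Φ t p D g f 0) (kgW κ Φ t p D g f 0) 30 ≤ 2 * (3 * (kgSL (nL κ Φ t p D g f) (ℓL κ Φ t p D g f) (hL κ Φ t p D g f))) := by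
    unfold kgCtr2 kgHw2; push_cast at eA hE2 hE3 hP hW h1 h2 h1' h2' ⊢; linarith
  simp only [KGRows.kgLastLo, KGRows.kgLastHi, Matrix.cons_val_one, Matrix.cons_val_zero]
  constructor <;> omega

/-- **THE PREFIX'S DEPTH ROW**: `13·(31·n_L + Z₀(30) + Z₁(30)) ≤ ZDP` (`Z₀ = X + R′ + 2n ≤ 14n + R′`, `Z₁ ≤ 7P + sL + sL + 31R′ + 21R′`). [this work] -/
theorem reachP_le (hN : EqNumL κ Φ t p D g f) (hg : gFloorKG κ Φ t p D mk ≤ g) (hg2 : 40 * Neg.K κ * KS0.R'0 κ Φ t p D mk ≤ g) :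
    13 * (((30 : ℕ) + 1 : ℤ) * (nL κ Φ t p D g f : ℤ) + (kgZ₀ (nL κ Φ t p D g f) (vL κ Φ t p D g f) (kgR κ Φ t p D mk) 0 (kgq κ Φ t p D g f 0) 30 (kgM₁ (nL κ Φ t p D g f) (ℓL κ Φ t p D g f) (hL κ Φ t p D g f) (kgR κ Φ t p D mk) 0 (kgW κ Φ t p D g f 0) 30) (kgM₂ (nL κ Φ t p D g f) (ℓL κ Φ t p D g f) (hL κ Φ t p D g f) (vL κ Φ t p D g f) (kgR κ Φ t p D mk) 0 (kgq κ Φ t p D g f 0) (kgW κ Φ t p D g f 0) 30)) + (kgZ₁ (nL κ Φ t p D g f) (ℓL κ Φ t p D g f) (hL κ Φ t p D g f) (kgR κ Φ t p D mk) 0 (kgW κ Φ t p D g f 0) 30 (kgM₁ (nL κ Φ t p D g f) (ℓL κ Φ t p D g f) (hL κ Φ t p D g f) (kgR κ Φ t p D mk) 0 (kgW κ Φ t p D g f 0) 30) (kgWm₂ (nL κ Φ t p D g f) (ℓL κ Φ t p D g f) (hL κ Φ t p D g f) (kgR κ Φ t p D mk) 0 (kgW κ Φ t p D g f 0) 30)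 (kgWp₂ (nL κ Φ t p D g f) (ℓL κ Φ t p D g f) (hL κ Φ t p D g f) (kgR κ Φ t p D mk) 0 (kgW κ Φ t p D g f 0) 30) (kgM₂ (nL κ Φ t p D g f) (ℓL κ Φ t p D g f) (hL κ Φ t p D g f) (vL κ Φ t p D g f) (kgR κ Φ t p D mk) 0 (kgq κ Φ t p D g f 0) (kgW κ Φ t p D g f 0) 30))) ≤ ((ZDP κ Φ t p D g f : ℕ) : ℤ) := by
  have H := (kgRows0_of κ Φ t p D g f mk 0 0 hN hg)
  obtain ⟨h0, h12⟩ := XP_bounds κ Φ t p D mk g f hN hg hg2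
  have ha := m₁P_le κ Φ t p D mk g f hN hg hg2
  have hb := m₂P_le κ Φ t p D mk g f hN hg hg2
  obtain ⟨-, hW, hRn, hRs, h958, -⟩ := prefix_floors κ Φ t p D mk g f hN hg hg2
  have hZ₀ := Skelφ.kgZ₀_eq (n := (nL κ Φ t p D g f)) (ℓ := (ℓL κ Φ t p D g f)) (hs := (hL κ Φ t p D g f)) (v := (vL κ Φ t p D g f)) (R' := (kgR κ Φ t p D mk)) (ρ := 0) (q := (kgq κ Φ t p D g f 0)) (W := (kgW κ Φ t p D g f 0)) 30
  have hZ₁ := H.kgZ₁_le 30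
  have hP : ((((nL κ Φ t p D g f) * (ℓL κ Φ t p D g f) / shearUnit (nL κ Φ t p D g f) (hL κ Φ t p D g f) : ℕ)) : ℤ) ≤ (kgSL (nL κ Φ t p D g f) (ℓL κ Φ t p D g f) (hL κ Φ t p D g f)) + 1 :=
    Skelφ.natDiv_le_kgSLY (n := (nL κ Φ t p D g f)) (one_le_of_eqNumL κ Φ t p D g f hN).1 (ℓL κ Φ t p D g f) (hL κ Φ t p D g f)
  have hs0 : 0 ≤ (kgSL (nL κ Φ t p D g f) (ℓL κ Φ t p D g f) (hL κ Φ t p D g f)) := by linarith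
  have eZ : ((ZDP κ Φ t p D g f : ℕ) : ℤ) = 13 * (46 * (nL κ Φ t p D g f : ℤ) + 10 * (kgSL (nL κ Φ t p D g f) (ℓL κ Φ t p D g f) (hL κ Φ t p D g f))) := by
    unfold ZDP; push_cast; rw [Int.toNat_of_nonneg hs0]
  have hRn' : 1600 * (((kgR κ Φ t p D mk) : ℕ) : ℤ) + 1 ≤ (nL κ Φ t p D g f : ℤ) := hRn
  have hR0 : (0 : ℤ) ≤ (((kgR κ Φ t p D mk) : ℕ) : ℤ) := by positivity
  have hm₁0 : (0 : ℤ) ≤ (((kgM₁ (nL κ Φ t p D g f) (ℓL κ Φ t p D g f) (hL κ Φ t p D g f) (kgR κ Φ t p D mk) 0 (kgW κ Φ t p D g f 0) 30) : ℕ) : ℤ) := by positivity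
  have hm₂0 : (0 : ℤ) ≤ (((kgM₂ (nL κ Φ t p D g f) (ℓL κ Φ t p D g f) (hL κ Φ t p D g f) (vL κ Φ t p D g f) (kgR κ Φ t p D mk) 0 (kgq κ Φ t p D g f 0) (kgW κ Φ t p D g f 0) 30) : ℕ) : ℤ) := by positivity
  have hm : ((((((kgM₁ (nL κ Φ t p D g f) (ℓL κ Φ t p D g f) (hL κ Φ t p D g f) (kgR κ Φ t p D mk) 0 (kgW κ Φ t p D g f 0) 30) : ℕ) : ℤ)) + ((kgM₂ (nL κ Φ t p D g f) (ℓL κ Φ t p D g f) (hL κ Φ t p D g f) (vL κ Φ t p D g f) (kgR κ Φ t p D mk) 0 (kgq κ Φ t p D g f 0) (kgW κ Φ t p D g f 0) 30) : ℕ) + 2) * ((((kgR κ Φ t p D mk) : ℕ) : ℤ) + ((0 : ℕ) : ℤ))) ≤ 21 * (((kgR κ Φ t p D mk) : ℕ) : ℤ) := by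
    push_cast; nlinarith
  rw [eZ, hZ₀]
  push_cast at hZ₁ hP hW hm ⊢
  linarith

/-- **THE PREFIX'S LENGTH**: `30 + 1 + (m₁(30)+1) + (m₂(30)+1) ≤ 52`. [this work] -/
theorem schedLenP_le (hN : EqNumL κ Φ t p D g f) (hg : gFloorKG κ Φ t p D mk ≤ g) (hg2 : 40 * Neg.K κ * KS0.R'0 κ Φ t p D mk ≤ g) : Nx + 1 + ((kgM₁ (nL κ Φ t p D g f) (ℓL κ Φ t p D g f) (hL κ Φ t p D g f) (kgR κ Φ t p D mk) 0 (kgW κ Φ t p D g f 0) Nx) + 1) + ((kgM₂ (nL κ Φ t p D g f) (ℓL κ Φ t p D g f) (hL κ Φ t p D g f) (vL κ Φ t p D g f) (kgR κ Φ t p D mk) 0 (kgq κ Φ t p D g f 0) (kgW κ Φ t p D g f 0) Nx) + 1) ≤ 52 := by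
  have ha := m₁P_le κ Φ t p D mk g f hN hg hg2
  have hb := m₂P_le κ Φ t p D mk g f hN hg hg2
  rw [Nx_eq]
  have ha' : (kgM₁ (nL κ Φ t p D g f) (ℓL κ Φ t p D g f) (hL κ Φ t p D g f) (kgR κ Φ t p D mk) 0 (kgW κ Φ t p D g f 0) 30) + 1 ≤ 3 := by exact_mod_cast ha
  have hb' : (kgM₂ (nL κ Φ t p D g f) (ℓL κ Φ t p D g f) (hL κ Φ t p D g f) (vL κ Φ t p D g f) (kgR κ Φ t p D mk) 0 (kgq κ Φ t p D g f 0) (kgW κ Φ t p D g f 0) 30) + 1 ≤ 18 := by exact_mod_cast hb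
  omega

end Prefix

end KS

end NegB

end PlanarSkeletonFrm

end Summit.CriticalPhenomena.PercolationContinuityZ3.Theorems.Transplant

end
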